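import Summits.CriticalPhenomena.PercolationContinuityZ3.Theorems.PercNearOneGluingNoHeavyLowerTailSahiTangentLayerLaw
import Literature.Combinatorics.Sahi2008.PushForward
import Summits.CriticalPhenomena.PercolationContinuityZ3.Theorems.PercNearOneGluingNoHeavyLowerTailThreePartitionTwistedPrincipal
import Summits.CriticalPhenomena.PercolationContinuityZ3.Theorems.PercNearOneGluingNoHeavyLowerTailThreePartitionLift
import Literature.Probability.Percolation.ConditionalPositiveAssociationProofs
import HarnessLib

/-!
# `NoHeavyLowerTail` (crux stmt-CriticalPhenomena-4575), Sahi programme: **SPLITTING `E_n` BY AN EVENT, AND THE DELETION–CONTRACTION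
# LAW OF TOTAL `E_n` ALONG ONE COORDINATE OF A PRODUCT MEASURE** — (i) for ANY weight `w`, any event `Q` and any families `f, g`:
# `E_n(f_S·1_Q ; g_{Sᶜ}·1_{Qᶜ}) = −E_{|S|}^{w|_Q}(f|_S) · E_{|Sᶜ|}^{w|_{Qᶜ}}(g|_{Sᶜ})`; (ii) for the product weight `weight w` on `2^ι` and a
# coordinate `e` with sections `f^e(ω) = f(ω ∪ {e})`, `f_e(ω) = f(ω ∖ {e})`:
# `E_n(f) = E_n^{w_e·μ}(f^e) + E_n^{(1−w_e)·μ}(f_e) − Σ_{∅≠S⊊[n]} E^{w_e·μ}(f^e|_S)·E^{(1−w_e)·μ}(f_e|_{Sᶜ})`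

Support file (Sahi cell, seat `prim-sahi-p1`, generation 52; `--supports stmt-CriticalPhenomena-4575`); companion of
`…SahiTangentLayerProduct` / `…SahiTangentLayerLaw` (gen 52).  Pure proofs, NO definitions, no `sorry`, standard axioms.
Vocabulary: `sahiE`, `ex`, `pushWeight` (`Literature/Combinatorics/Sahi2008`), the product weight
`Literature.Probability.Percolation.BHK2006.weight w ω = Π_i (i ∈ ω ? w_i : 1 − w_i)` on `Set ι` (= `bernoulliWeight` for parameters in
`[0,1]`; the identities below hold for arbitrary real parameters); sub-families `sahiE μ S.card (fun j => g (S.orderEmbOfFin rfl j))`.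

THE MATHEMATICS.
* §1 `sahiE_split_by_event` — the product formula of `…SahiTangentLayerProduct` read for an EVENT `Q` of the space: the family with slots
  `f_l·1_Q` (`l ∈ S`) and `g_l·1_{Qᶜ}` (`l ∉ S`) — two groups supported on the two sides of `Q` — has
  `E_n = −E_{|S|}^{w·1_Q}(f|_S) · E_{|Sᶜ|}^{w·1_{Qᶜ}}(g|_{Sᶜ})` (restricted weights; by the scaling theorem `sahiE_smul_weight_eq_sum` these are
  `Σ_π φ_{|π|}(w(Q)) Π E^{w(·|Q)}(…)`); `≤ 0` when both factors are `≥ 0` (`sahiE_split_by_event_nonpos`) — the exact form of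
  "mutually exclusive groups of events are negatively Sahi-correlated" (`n = 2`: `Cov(A∩Q, B∩Qᶜ) = −P(A∩Q)P(B∩Qᶜ)`).
* §2 `pushWeight_coin_edge` — resampling one coordinate: the map `(ε, ω) ↦ ε ? ω ∪ {e} : ω ∖ {e}` pushes `B_{w_e} ⊗ weight w` forward to
  `weight w`; hence (`sahiE_weight_edge_eq_layers`) THE DELETION–CONTRACTION LAW displayed in the title (the coin form
  `sahiE_coin_pair_eq_layers` of the law of total `E_n`, transported).  PERCOLATION READING (`ι` = edges, `f_l = 1_{A_l}`): `f^e = 1_{A_l}` computed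
  with `e` forced open (for connection events: connection in `G/e`), `f_e` with `e` forced closed (connection in `G − e`), so
  `E_n^{G}(A) = E_n^{p_e·P}(A ; G/e) + E_n^{(1−p_e)·P}(A ; G−e) − Σ_{∅≠S⊊[n]} E^{p_e·P}(A_S ; G/e) · E^{(1−p_e)·P}(A_{Sᶜ} ; G−e)`,
  every term a functional of ONE minor; with `sahiE_weight_edge_le` / `sahiE_weight_edge_nonneg_iff` (Sahi positivity along an edge ⟺ the
  cross terms are dominated by the two pure minors).  Companion of gen 51's exact DEFECT formula (memo gen51 §4, `(E¹−E⁰, E⁰)` basis).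
Nothing conjectural is asserted. [this work; mechanism: Sahi2008 eq. (3)/(14)]
-/

namespace Summit.CriticalPhenomena.PercolationContinuityZ3.Theorems.SahiTangent

open Finset Function Literature.Combinatorics.Sahi2008
open scoped BigOperators

noncomputable section

/-! ### §1 Splitting `E_n` by an event -/

section Event

variable {β : Type*} [Fintype β] [DecidableEq β]

/-- A family supported inside `Q` has the `E_n` of the restricted weight `w·1_Q`. [this work] -/
theorem sahiE_restrict_event (w : β → ℝ) (Q : Finset β) {p : ℕ} (h : Fin p → β → ℝ) :
    sahiE w p (fun r x => if x ∈ Q then h r x else 0) = sahiE (fun x => if x ∈ Q then w x else 0) p h := by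
  refine sahiE_congr_of_moments _ _ p _ _ fun S hS => ?_
  simp only [ex]
  refine Finset.sum_congr rfl fun x _ => ?_
  rw [Finset.prod_apply, Finset.prod_apply]
  by_cases hx : x ∈ Q
  · simp only [hx, if_true]
  · simp only [hx, if_false, zero_mul]
    obtain ⟨i, hi⟩ := hS
    rw [Finset.prod_eq_zero hi rfl, mul_zero]

/-- A family supported outside `Q` has the `E_n` of the restricted weight `w·1_{Qᶜ}`. [this work] -/
theorem sahiE_restrict_event_compl (w : β → ℝ) (Q : Finset β) {p : ℕ} (h : Fin p → β → ℝ) :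
    sahiE w p (fun r x => if x ∈ Q then 0 else h r x) = sahiE (fun x => if x ∈ Q then 0 else w x) p h := by
  refine sahiE_congr_of_moments _ _ p _ _ fun S hS => ?_
  simp only [ex]
  refine Finset.sum_congr rfl fun x _ => ?_
  rw [Finset.prod_apply, Finset.prod_apply]
  by_cases hx : x ∈ Q
  · simp only [hx, if_true, zero_mul]
    obtain ⟨i, hi⟩ := hS
    rw [Finset.prod_eq_zero hi rfl, mul_zero]
  · simp only [hx, if_false]

/-- **Splitting `E_n` by an event.**  For ANY real weight `w` on a finite type, any event `Q`, families `f, g` and a proper nonempty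
set of slots `S`: the family with slots `f_l·1_Q` (`l ∈ S`) and `g_l·1_{Qᶜ}` (`l ∉ S`) has
`E_n = −E_{|S|}^{w·1_Q}(f|_S) · E_{|Sᶜ|}^{w·1_{Qᶜ}}(g|_{Sᶜ})`. [this work] -/
theorem sahiE_split_by_event (w : β → ℝ) (Q : Finset β) {n : ℕ} (f g : Fin n → β → ℝ) (S : Finset (Fin n))
    (hS : S.Nonempty) (hS' : S ≠ univ) :
    sahiE w n (fun l x => if l ∈ S then (if x ∈ Q then f l x else 0) else (if x ∈ Q then 0 else g l x))
      = -(sahiE (fun x => if x ∈ Q then w x else 0) S.card (fun j => f (S.orderEmbOfFin rfl j))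
          * sahiE (fun x => if x ∈ Q then 0 else w x) Sᶜ.card (fun j => g (Sᶜ.orderEmbOfFin rfl j))) := by
  classical
  have hSc : Sᶜ.Nonempty := by
    rw [Finset.nonempty_iff_ne_empty, Ne, Finset.compl_eq_empty_iff]; exact hS'
  obtain ⟨m, rfl⟩ : ∃ m, n = m + 2 := by
    have h2 : 2 ≤ n := by
      have h := Finset.card_le_univ (S ∪ Sᶜ)
      have hc : (S ∪ Sᶜ).card = S.card + Sᶜ.card := Finset.card_union_of_disjoint disjoint_compl_right
      rw [Fintype.card_fin] at h
      have := hS.card_pos; have := hSc.card_pos; omega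
    exact ⟨n - 2, by omega⟩
  set e₁ : Fin S.card → Fin (m + 2) := fun r => S.orderEmbOfFin rfl r with he₁_def
  set e₂ : Fin Sᶜ.card → Fin (m + 2) := fun r => Sᶜ.orderEmbOfFin rfl r with he₂_def
  have hm₁ : ∀ r, e₁ r ∈ S := fun r => Finset.orderEmbOfFin_mem S rfl r
  have hm₂' : ∀ r, e₂ r ∉ S := fun r => Finset.mem_compl.1 (Finset.orderEmbOfFin_mem Sᶜ rfl r)
  rw [sahiE_eq_neg_mul_of_cross_moments _ m S.card Sᶜ.card _ e₁ e₂ (S.orderEmbOfFin rfl).strictMono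
    (Sᶜ.orderEmbOfFin rfl).strictMono hS.card_pos hSc.card_pos
    (fun r r' h => hm₂' r' (h ▸ hm₁ r)) (fun i => ?_) (fun T h1 h2 => ?_)]
  · congr 2
    · have : (fun r x => if e₁ r ∈ S then (if x ∈ Q then f (e₁ r) x else (0 : ℝ)) else (if x ∈ Q then 0 else g (e₁ r) x))
          = fun r x => if x ∈ Q then f (e₁ r) x else 0 := by
        funext r x; rw [if_pos (hm₁ r)]
      rw [this, sahiE_restrict_event]
    · have : (fun r x => if e₂ r ∈ S then (if x ∈ Q then f (e₂ r) x else (0 : ℝ)) else (if x ∈ Q then 0 else g (e₂ r) x))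
          = fun r x => if x ∈ Q then 0 else g (e₂ r) x := by
        funext r x; rw [if_neg (hm₂' r)]
      rw [this, sahiE_restrict_event_compl]
  · by_cases hi : i ∈ S
    · left
      have : i ∈ Set.range (S.orderEmbOfFin rfl) := by rw [Finset.range_orderEmbOfFin]; exact hi
      obtain ⟨r, hr⟩ := this
      exact ⟨r, hr⟩
    · right
      have : i ∈ Set.range (Sᶜ.orderEmbOfFin rfl) := by
        rw [Finset.range_orderEmbOfFin]; exact Finset.mem_compl.2 hi
      obtain ⟨r, hr⟩ := this
      exact ⟨r, hr⟩
  · obtain ⟨r₁, hr₁⟩ := h1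
    obtain ⟨r₂, hr₂⟩ := h2
    simp only [ex]
    refine Finset.sum_eq_zero fun x _ => ?_
    rw [Finset.prod_apply]
    by_cases hx : x ∈ Q
    · rw [Finset.prod_eq_zero hr₂ (by rw [if_neg (hm₂' r₂), if_pos hx]), mul_zero]
    · rw [Finset.prod_eq_zero hr₁ (by rw [if_pos (hm₁ r₁), if_neg hx]), mul_zero]

/-- Hence: if the `Q`-group and the `Qᶜ`-group have nonnegative restricted functionals, the split family has `E_n ≤ 0`
("mutually exclusive groups are negatively Sahi-correlated"). [this work] -/
theorem sahiE_split_by_event_nonpos (w : β → ℝ) (Q : Finset β) {n : ℕ} (f g : Fin n → β → ℝ) (S : Finset (Fin n))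
    (hS : S.Nonempty) (hS' : S ≠ univ)
    (hf : 0 ≤ sahiE (fun x => if x ∈ Q then w x else 0) S.card (fun j => f (S.orderEmbOfFin rfl j)))
    (hg : 0 ≤ sahiE (fun x => if x ∈ Q then 0 else w x) Sᶜ.card (fun j => g (Sᶜ.orderEmbOfFin rfl j))) :
    sahiE w n (fun l x => if l ∈ S then (if x ∈ Q then f l x else 0) else (if x ∈ Q then 0 else g l x)) ≤ 0 := by
  rw [sahiE_split_by_event w Q f g S hS hS']
  exact neg_nonpos.2 (mul_nonneg hf hg)

end Event

/-! ### §2 The deletion–contraction law of total `E_n` along one coordinate of a product weight -/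

section Edge

open Literature.Probability.Percolation.BHK2006 (weight)
open ThreePartition (insert_sdiff_singleton_of_mem insert_sdiff_singleton_of_notMem)
open scoped Classical

variable {ι : Type*} [Fintype ι]

/-- The product weight factorises off the coordinate `e`. [folklore] -/
theorem weight_eq_mul_prod_erase (w : ι → ℝ) (e : ι) (ω : Set ι) :
    weight w ω = (if e ∈ ω then w e else 1 - w e) * ∏ i ∈ univ.erase e, (if i ∈ ω then w i else 1 - w i) := by
  classical
  unfold weight
  rw [Finset.mul_prod_erase univ (fun i => if i ∈ ω then w i else 1 - w i) (Finset.mem_univ e)]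

/-- Off `e`, two configurations that agree off `e` have the same off-`e` factor. [folklore] -/
theorem prod_erase_congr_off (w : ι → ℝ) (e : ι) {ω τ : Set ι} (h : ∀ i, i ≠ e → (i ∈ τ ↔ i ∈ ω)) :
    ∏ i ∈ univ.erase e, (if i ∈ τ then w i else 1 - w i) = ∏ i ∈ univ.erase e, (if i ∈ ω then w i else 1 - w i) :=
  Finset.prod_congr rfl fun i hi => by rw [if_congr (h i (Finset.ne_of_mem_erase hi)) rfl rfl]

/-- The two configurations agreeing off `e` carry total product weight equal to the common off-`e` factor:
for `e ∉ ω`, `w_e·(weight (ω ∪ {e}) + weight ω) = weight (ω ∪ {e})` and `(1−w_e)·(…) = weight ω`. [folklore] -/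
theorem weight_pair_of_notMem (w : ι → ℝ) {e : ι} {ω : Set ι} (he : e ∉ ω) :
    w e * (weight w (insert e ω) + weight w ω) = weight w (insert e ω)
      ∧ (1 - w e) * (weight w (insert e ω) + weight w ω) = weight w ω := by
  rw [weight_eq_mul_prod_erase w e (insert e ω), weight_eq_mul_prod_erase w e ω,
    prod_erase_congr_off w e (ω := ω) (τ := insert e ω) (fun i hi => by simp [Set.mem_insert_iff, hi]),
    if_pos (Set.mem_insert e ω), if_neg he]
  constructor <;> ring

/-- **Resampling one coordinate.**  The map `(ε, ω) ↦ ε ? ω ∪ {e} : ω ∖ {e}` pushes the coin product `B_{w_e} ⊗ weight w` on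
`Bool × 2^ι` forward to `weight w` (any real parameters). [folklore] -/
theorem pushWeight_coin_edge (w : ι → ℝ) (e : ι) :
    pushWeight (fun z : Bool × Set ι => if z.1 then w e * weight w z.2 else (1 - w e) * weight w z.2)
        (fun z : Bool × Set ι => if z.1 then insert e z.2 else z.2 \ {e}) = weight w := by
  classical
  funext τ
  rw [pushWeight_apply]
  simp only [Fintype.sum_prod_type, Fintype.sum_bool, if_true, Bool.false_eq_true, if_false]
  by_cases he : e ∈ τ
  · -- `e ∈ τ`: the preimages are `(1, τ)` and `(1, τ ∖ {e})`
    have hne : τ \ {e} ≠ τ := fun h => by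
      have : e ∈ τ \ {e} := h.symm ▸ he
      exact this.2 rfl
    have h1 : ∀ ω : Set ι, (insert e ω = τ) ↔ (ω = τ ∨ ω = τ \ {e}) := by
      intro ω
      constructor
      · intro h
        by_cases heω : e ∈ ω
        · left; rwa [Set.insert_eq_of_mem heω] at h
        · right; rw [← h, insert_sdiff_singleton_of_notMem heω]
      · rintro (rfl | rfl)
        · exact Set.insert_eq_of_mem he
        · exact insert_sdiff_singleton_of_mem he
    have h2 : ∀ ω : Set ι, ω \ {e} ≠ τ := fun ω h => by
      have : e ∈ ω \ {e} := h.symm ▸ he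
      exact this.2 rfl
    simp only [h2, if_false, Finset.sum_const_zero, add_zero]
    rw [show (∑ ω : Set ι, if insert e ω = τ then w e * weight w ω else 0)
        = ∑ ω ∈ ({τ, τ \ {e}} : Finset (Set ι)), w e * weight w ω from ?_]
    · rw [Finset.sum_pair hne.symm]
      have hτ : insert e (τ \ {e}) = τ := insert_sdiff_singleton_of_mem he
      have h := (weight_pair_of_notMem w (show e ∉ τ \ {e} from fun h => h.2 rfl)).1
      rw [hτ] at h
      rw [← mul_add, h]
    · rw [← Finset.sum_filter]
      congr 1
      ext ω
      simp only [Finset.mem_filter, Finset.mem_univ, true_and, Finset.mem_insert, Finset.mem_singleton, h1]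
  · -- `e ∉ τ`: the preimages are `(0, τ)` and `(0, τ ∪ {e})`
    have hne : insert e τ ≠ τ := fun h => he (h ▸ Set.mem_insert e τ)
    have h1 : ∀ ω : Set ι, insert e ω ≠ τ := fun ω h => he (h ▸ Set.mem_insert e ω)
    have h2 : ∀ ω : Set ι, (ω \ {e} = τ) ↔ (ω = τ ∨ ω = insert e τ) := by
      intro ω
      constructor
      · intro h
        by_cases heω : e ∈ ω
        · right; rw [← h, insert_sdiff_singleton_of_mem heω]
        · left; rwa [Set.sdiff_singleton_eq_self heω] at h
      · rintro (rfl | rfl)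
        · exact Set.sdiff_singleton_eq_self he
        · exact insert_sdiff_singleton_of_notMem he
    simp only [h1, if_false, Finset.sum_const_zero, zero_add]
    rw [show (∑ ω : Set ι, if ω \ {e} = τ then (1 - w e) * weight w ω else 0)
        = ∑ ω ∈ ({τ, insert e τ} : Finset (Set ι)), (1 - w e) * weight w ω from ?_]
    · rw [Finset.sum_pair hne.symm, ← mul_add, add_comm]
      exact (weight_pair_of_notMem w he).2
    · rw [← Finset.sum_filter]
      congr 1
      ext ω
      simp only [Finset.mem_filter, Finset.mem_univ, true_and, Finset.mem_insert, Finset.mem_singleton, h2]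

/-- **THE DELETION–CONTRACTION LAW OF TOTAL `E_n` ALONG ONE COORDINATE (all orders).**  For the product weight `μ = weight w` on
`2^ι` (any real parameters), a coordinate `e`, any `n` and any functions `f_l : 2^ι → ℝ`, with the sections `f^e_l(ω) = f_l(ω ∪ {e})`
(`e` forced in) and `f_{e,l}(ω) = f_l(ω ∖ {e})` (`e` forced out):
`E_n^{μ}(f) = E_n^{w_e·μ}(f^e) + E_n^{(1−w_e)·μ}(f_e) − Σ_{∅≠S⊊[n]} E_{|S|}^{w_e·μ}(f^e|_S) · E_{|Sᶜ|}^{(1−w_e)·μ}(f_e|_{Sᶜ})`.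
(The sections ignore the coordinate `e`, so their functionals are functionals on the sub-cube `2^{ι∖e}`; the scaled functionals expand in
products of `μ`-functionals by `sahiE_smul_weight_eq_sum`.)  Percolation: `E_n(A) = E_n^{p_e·P}(A; G/e) + E_n^{(1−p_e)·P}(A; G−e) − Σ …`.
[this work; mechanism: Sahi2008 eq. (3)/(14)] -/
theorem sahiE_weight_edge_eq_layers (w : ι → ℝ) (e : ι) {n : ℕ} (f : Fin n → Set ι → ℝ) :
    sahiE (weight w) n f
      = sahiE (w e • weight w) n (fun l ω => f l (insert e ω)) + sahiE ((1 - w e) • weight w) n (fun l ω => f l (ω \ {e}))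
        - ∑ S : Finset (Fin n) with (S.Nonempty ∧ S ≠ univ),
            sahiE (w e • weight w) S.card (fun j ω => f (S.orderEmbOfFin rfl j) (insert e ω))
              * sahiE ((1 - w e) • weight w) Sᶜ.card (fun j ω => f (Sᶜ.orderEmbOfFin rfl j) (ω \ {e})) := by
  have h := sahiE_pushWeight (fun z : Bool × Set ι => if z.1 then w e * weight w z.2 else (1 - w e) * weight w z.2)
    (fun z : Bool × Set ι => if z.1 then insert e z.2 else z.2 \ {e}) n f
  rw [pushWeight_coin_edge] at h
  rw [h]
  have hfam : (fun i => f i ∘ fun z : Bool × Set ι => if z.1 then insert e z.2 else z.2 \ {e})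
      = fun l (z : Bool × Set ι) => if z.1 then f l (insert e z.2) else f l (z.2 \ {e}) := by
    funext l z
    simp only [Function.comp_apply]
    split_ifs <;> rfl
  rw [hfam]
  exact sahiE_coin_pair_eq_layers (weight w) (w e) (fun l ω => f l (insert e ω)) (fun l ω => f l (ω \ {e}))

/-- **Upper bound by the two minors.**  If the proper sub-families of the `e`-open sections are Sahi-nonnegative under `w_e·μ` and
those of the `e`-closed sections under `(1−w_e)·μ`, then `E_n^{μ}(f) ≤ E_n^{w_e·μ}(f^e) + E_n^{(1−w_e)·μ}(f_e)`. [this work] -/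
theorem sahiE_weight_edge_le (w : ι → ℝ) (e : ι) {n : ℕ} (f : Fin n → Set ι → ℝ)
    (h₁ : ∀ S : Finset (Fin n), S.Nonempty → S ≠ univ →
      0 ≤ sahiE (w e • weight w) S.card (fun j ω => f (S.orderEmbOfFin rfl j) (insert e ω)))
    (h₀ : ∀ S : Finset (Fin n), S.Nonempty → S ≠ univ →
      0 ≤ sahiE ((1 - w e) • weight w) S.card (fun j ω => f (S.orderEmbOfFin rfl j) (ω \ {e}))) :
    sahiE (weight w) n f
      ≤ sahiE (w e • weight w) n (fun l ω => f l (insert e ω)) + sahiE ((1 - w e) • weight w) n (fun l ω => f l (ω \ {e})) := by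
  classical
  rw [sahiE_weight_edge_eq_layers w e f]
  refine sub_le_self _ (Finset.sum_nonneg fun S hS => ?_)
  have h := (Finset.mem_filter.1 hS).2
  have hc1 : Sᶜ.Nonempty := by
    rw [Finset.nonempty_iff_ne_empty, Ne, Finset.compl_eq_empty_iff]; exact h.2
  have hc2 : Sᶜ ≠ univ := by
    rw [Ne, Finset.compl_eq_univ_iff]; exact h.1.ne_empty
  exact mul_nonneg (h₁ S h.1 h.2) (h₀ Sᶜ hc1 hc2)

/-- **Sahi positivity along an edge, reformulated**: `0 ≤ E_n^{μ}(f)` iff the cross terms are dominated by the two pure minors,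
`Σ_{∅≠S⊊[n]} E^{w_e·μ}(f^e|_S)·E^{(1−w_e)·μ}(f_e|_{Sᶜ}) ≤ E_n^{w_e·μ}(f^e) + E_n^{(1−w_e)·μ}(f_e)`. [this work] -/
theorem sahiE_weight_edge_nonneg_iff (w : ι → ℝ) (e : ι) {n : ℕ} (f : Fin n → Set ι → ℝ) :
    0 ≤ sahiE (weight w) n f
      ↔ ∑ S : Finset (Fin n) with (S.Nonempty ∧ S ≠ univ),
            sahiE (w e • weight w) S.card (fun j ω => f (S.orderEmbOfFin rfl j) (insert e ω))
              * sahiE ((1 - w e) • weight w) Sᶜ.card (fun j ω => f (Sᶜ.orderEmbOfFin rfl j) (ω \ {e}))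
          ≤ sahiE (w e • weight w) n (fun l ω => f l (insert e ω)) + sahiE ((1 - w e) • weight w) n (fun l ω => f l (ω \ {e})) := by
  rw [sahiE_weight_edge_eq_layers w e f, sub_nonneg]

end Edge

end

end Summit.CriticalPhenomena.PercolationContinuityZ3.Theorems.SahiTangent
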